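import Summits.HodgeConjecture.CorCM.Census.OcticCyclicSpecies
import Summits.HodgeConjecture.CorCM.Census.OcticQuaternionSpecies
import Summits.HodgeConjecture.CorCM.Census.OcticC4C2SquareSpecies
import Mathlib.GroupTheory.Index

/-!
# Octic atlas, rows `ℤ/8`, `Q₈` and `ℤ/4 × ℤ/2` (`c` a square) — the WEIL COLUMN is EMPTY: no imaginary quadratic subfield; what the proper
# CM subfields see (kernel census)

COR-CM (cell `pub-hodgecm2`), count-neutral kernel census by the PORTFOLIO seat lit-andre-3 (gen 11); third file of the octic WEIL COLUMN after
`Census/OcticTriquadraticWeilColumn.lean` (type `(ℤ/2)³`; its module docstring states the QUESTION — which exceptional classes of an octic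
slice are reached by Weil classes `⋀^{2n}_{k} H¹(X)` of IMAGINARY QUADRATIC fields `k` (the classes of Schoen, van Geemen, Markman) or by
generalised Weil classes `⋀^r_K H¹(X)` of other CM subfields `K` [cite: MoonenZarhin1998WeilClasses, §2] — and the dictionaries (W), (W′): the
type lattice of `K = F^H` is the lattice of `H`-invariant Pohlmann–Hodge vectors) and `Census/OcticC4C2NonsquareWeilColumn.lean`.  The three rows
here are the octic types WITHOUT an imaginary quadratic subfield (the order-`12` analogue is seat b17's `Census/DodecicRealQuadraticRowsWeilColumn.lean`);
models from this lineage's `Census/OcticCyclicSpecies.lean`, `Census/OcticQuaternionSpecies.lean`, `Census/OcticC4C2SquareSpecies.lean` (gen 8).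
Cell note `HOME/pub-hodgecm2-lit-andre-3/PORTFOLIO-lit-andre-3-g11.md`.  No named fact, no geometry, no `sorry`: `decide`, `omega`, two group lemmas.

KERNEL.
* `OcticCyclicSpecies.conj_mem_of_ne_bot`, `OcticQuaternionSpecies.conj_mem_of_ne_bot`: in `ℤ/8` and `Q₈` EVERY non-trivial subgroup contains
  `c` — these fields have no proper CM subfield whatsoever; by (W′)/(W1) every Weil class of a CM field `K′ ⊉ F` on a member of the slice is of
  divisor type, so the atoms (`ℤ/8`: `μ = 1`, `H¹(B₀) ⊗ N`; `Q₈`: `μ = 2`) are PURE FACE CLASSES: only André's `F`-Weil lines on `4`-slot products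
  reach them (exact oracle `scratch/genweil.py`: `H/(P + Σ_{K ≠ F} W_K) = H/P ≅ ℤ⁴`).
* `OcticC4C2SquareSpecies.conj_mem_of_index_two` (no imaginary quadratic subfield ⇒ `W_k ⊂ P`: Markman-type theorems give nothing here),
  `cm_subgroups_census` (the subgroups avoiding `c` are `0`, `⟨(0,1)⟩`, `⟨(2,1)⟩`: the CM subfields are `F`, `K₀`, `K₁`, the cyclic quartic CM fields of `S₀`, `S₁`), `act_tables`,
  `invariant_S0deg_even` (generalised Weil types of `K₀` and of `K₁` have even `S₀`-degree), `atom_rows` (`orbitRep 0` = `S₁ × B (2,2)` IS the type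
  of the generalised Weil class `⋀⁴_{K₁} H¹(S₁² × B)`; `orbitRep 1` = `S₀ × S₁ × B (1,1,2)` has odd `S₀`-degree): exact oracle
  `H/(P + W_{K₀} + W_{K₁}) ≅ ℤ/2` (each `W_{K_i}` alone: rank `10`) — one atom orbit of generalised-Weil kind, one of pure face kind.

THE OCTIC WEIL COLUMN IN ONE TABLE (exact oracle, all six Galois CM closure types of order `8`; «k» = imaginary quadratic subfields, «K» = quartic
CM subfields, quotients of the Hodge lattice `H` (rank `12`, `P` = pairs of rank `8`, `μ` = number of atom orbits of the atlas):
  `ℤ/8`: no k, no K — `H/(P+W) ≅ ℤ⁴`: faces only (`μ = 1`).  `Q₈`: no k, no K — `ℤ⁴`: faces only (`μ = 2`).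
  `ℤ/4×ℤ/2`, `c ∈ G²`: no k; `K₀, K₁` cyclic — `P + W_K`: full rank, index `2` (`μ = 2`: one generalised-Weil atom on `S₁² × B`, one face atom).
  `ℤ/4×ℤ/2`, `c ∉ G²`: `k₀, k₁` — `P + W_k` rank `10`, `H/(P+W_k) ≅ ℤ/2 ⊕ ℤ²`, the one-curve sub-slices `E_i^a × B^n` GENERATED (Weil sixfolds
    `B × E_i²`, Markman); `+ W_K` (`k₀k₁`, `K_S`): index `2` (`μ = 2`: one generalised-Weil atom on `E₀² × E₁² × B`, one face atom `E₁ × S × B`).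
  `(ℤ/2)³`: `k₀..k₃` — `P + W_k` full rank, index `8 = 2^μ` (`= ker` of the three parity characters), one-curve sub-slices GENERATED (sixfolds
    `B × E_i²`); six biquadratic `K_{ij}`: index `1` — all three atom orbits are generalised Weil classes on eightfolds `E_i² × E_j² × B`.
  `D₄` (`c = r²`, gen 7's four-core `S₁, S₂, S₁′, S₂′`): no k (every index-`2` subgroup contains `r²`); the four non-Galois quartic CM subfields
    `K₁, K₁′, K₂, K₂′` (fixed fields of the reflections): index `1` — both F-9 atoms are generalised Weil classes, smallest carriers = eightfolds `S_a × S_b × S_c²` on three of the four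
    surfaces (`K`-rank `4`; exact oracle `scratch/genweil2.py`).
  (`ℤ/10`, decic: `k` only — `W_k` of rank `3` mod `P`, the three one-curve sub-slices generated by the sixfolds `E × B₀`, `E × B₂` and the
    EIGHTFOLD `E³ × B₁`; `H/(P + W_k) ≅ ℤ⁸`: faces only — cf. `Census/DecicCyclicWeilPlanes.lean`.)
READING (informal; HC_CM is NOT proved anywhere here).  Theorems on Weil classes of imaginary quadratic fields (Schoen 1988, van Geemen, Markman
2025: `Markman2025_weilClasses_algebraic_abelianFourfold`, `Markman2025_weilClasses_algebraic_hyperbolicSixfold`) can close, inside (O1)–(O3), exactly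
the one-curve sub-slices of the two types with an imaginary quadratic subfield and NOTHING ELSE in degree `8`; the remaining atoms are either
instances of Moonen–Zarhin's question for quartic CM fields on explicit CM eightfolds (`(ℤ/2)³`, `D₄` entirely; one orbit in each `ℤ/4×ℤ/2` type) or
pure rank-four FACE classes (`ℤ/8`, `Q₈`, the other orbit of each `ℤ/4×ℤ/2` type) — the classes the cell's `W_RK4`/`PerLFace` is about.

## References
* [Pohlmann1968] H. Pohlmann, Ann. of Math. 88 (1968), Thm 1.  [MoonenZarhin1998WeilClasses] B. Moonen, Yu. Zarhin, J. reine angew. Math. 496 (1998)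
  = alg-geom/9612017, §2 (`W_K`, Criterion).  [MoonenZarhin1999LowDim] B. Moonen, Yu. Zarhin, Math. Ann. 315 (1999), (1.9).
  [Markman2025SecantWeil] E. Markman, arXiv:2502.03415, Thm 1.5.1 (what does NOT apply in these rows).

## Provenance
Exact oracles in the seat folder `scratch/` (copies `HOME/pub-hodgecm2-lit-andre-3/g11/`): `weilcol.py`, `genweil.py`, `genweil2.py`, `octic_models.py`,
`octic_weil_analysis.py`; generator `gen_rows.py` (this file).
-/

open Finset

/-! ## Row `ℤ/8`: no proper CM subfield at all -/

namespace Summit.HodgeConjecture.CorCM.Census.OcticCyclicSpecies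

/-- **Every non-trivial subgroup of `G = ℤ/8` contains `c = 4`**: every proper subfield of a cyclic octic CM field `F` is totally real, `F`
has NO proper CM subfield (in particular no imaginary quadratic one).  Consequence ((W′)/(W1) of `Census/OcticTriquadraticWeilColumn.lean`,
cell note §1): for every member `X` of the `F`-slice and every CM field `K′ ⊂ End⁰(X)` not containing a copy of `F`, the Weil classes
`⋀^r_{K′} H¹(X)` [cite: MoonenZarhin1998WeilClasses, §2] have their types in the pair lattice `P` (complex conjugation of `K′` is induced by
an automorphism fixing `F`); the only other case, `K′ ⊇ F`, is André's: `F`-Weil lines on `4`-slot products (the rank-four FACES).  So the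
atom of this row (`orbitRep 0`, `H¹(B₀) ⊗ N ⊂ H⁴(B₀ × B₁)`) is reachable by NO theorem about Weil classes of proper subfields — Markman's
theorems included —, only by face classes: `H/P ≅ ℤ⁴` is untouched by every proper-subfield Weil lattice (exact oracle `scratch/genweil.py`).
[folklore] -/
theorem conj_mem_of_ne_bot (H : AddSubgroup (ZMod 8)) (hH : H ≠ ⊥) : (4 : ZMod 8) ∈ H := by
  obtain ⟨x, hx, hx0⟩ : ∃ x ∈ H, x ≠ 0 := (AddSubgroup.bot_or_exists_ne_zero H).resolve_left hH
  have key : ∀ y : ZMod 8, y ≠ 0 → ∃ k : Fin 8, (k : ℕ) • y = 4 := by decide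
  obtain ⟨k, hk⟩ := key x hx0
  exact hk ▸ H.nsmul_mem hx k

end Summit.HodgeConjecture.CorCM.Census.OcticCyclicSpecies

/-! ## Row `Q₈`: no proper CM subfield at all -/

namespace Summit.HodgeConjecture.CorCM.Census.OcticQuaternionSpecies

open QuaternionGroup

/-- **Every non-trivial subgroup of `G = Q₈` contains `c = a 2`** (the unique involution): a `Q₈`-CM field has NO proper CM subfield; as
for `ℤ/8`, every Weil class w.r.t. a CM field `K′ ⊂ End⁰(X)`, `K′ ⊉ F`, on a member of the slice has its type in `P`, and the two atoms of
this row (`orbitRep 0, 1` on `B₀ × B₁`, Künneth `(2,2)`) are reachable only by `F`-face classes. [folklore] -/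
theorem conj_mem_of_ne_bot (H : Subgroup (QuaternionGroup 2)) (hH : H ≠ ⊥) : (a 2 : QuaternionGroup 2) ∈ H := by
  obtain ⟨x, hx, hx0⟩ : ∃ x ∈ H, x ≠ 1 := (Subgroup.bot_or_exists_ne_one H).resolve_left hH
  have key : ∀ y : QuaternionGroup 2, y ≠ 1 → ∃ k : Fin 4, y ^ (k : ℕ) = a 2 := by decide
  obtain ⟨k, hk⟩ := key x hx0
  exact hk ▸ H.pow_mem hx k

end Summit.HodgeConjecture.CorCM.Census.OcticQuaternionSpecies

/-! ## Row `ℤ/4 × ℤ/2` with `c = (2,0)` a square: no imaginary quadratic subfield, two cyclic quartic CM subfields -/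

namespace Summit.HodgeConjecture.CorCM.Census.OcticC4C2SquareSpecies

/-- **`c = (2,0)` lies in every index-`2` subgroup** (`c = (1,0) + (1,0)`): every quadratic subfield of `F` is REAL — no Weil class w.r.t.
an imaginary quadratic field, on any member of the slice, has exceptional type ((W1)): Markman-type theorems reach NOTHING beyond divisors in
this row (exact oracle: `W_{k′} ⊂ P` for all `k′`). [folklore] -/
theorem conj_mem_of_index_two (H : AddSubgroup (ZMod 4 × ZMod 2)) (hH : H.index = 2) : ((2 : ZMod 4), (0 : ZMod 2)) ∈ H := by
  have h := AddSubgroup.add_self_mem_of_index_two hH ((1 : ZMod 4), (0 : ZMod 2))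
  have e : ((1 : ZMod 4), (0 : ZMod 2)) + ((1 : ZMod 4), (0 : ZMod 2)) = ((2 : ZMod 4), (0 : ZMod 2)) := by decide
  exact e ▸ h

/-- **CM-subfield census**: every `g ∉ {0, (0,1), (2,1)}` has a multiple equal to `c = (2,0)`, and `(0,1) + (2,1) = c` — so the subgroups of
`G` avoiding `c` are exactly `0`, `⟨(0,1)⟩`, `⟨(2,1)⟩`: the CM subfields of `F` are `F` and the two CYCLIC QUARTIC fields `K₀ = F^{⟨(0,1)⟩}` (the
CM field of `S₀`) and `K₁ = F^{⟨(2,1)⟩}` (the CM field of `S₁`). [folklore] -/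
theorem cm_subgroups_census : (∀ g : ZMod 4 × ZMod 2, g ≠ 0 → g ≠ ((0 : ZMod 4), (1 : ZMod 2)) → g ≠ ((2 : ZMod 4), (1 : ZMod 2)) →
      ∃ k : Fin 4, (k : ℕ) • g = ((2 : ZMod 4), (0 : ZMod 2))) ∧
    ((0 : ZMod 4), (1 : ZMod 2)) + ((2 : ZMod 4), (1 : ZMod 2)) = ((2 : ZMod 4), (0 : ZMod 2)) := by
  refine ⟨by decide, by decide⟩

/-- The action tables of the two involutions `(0,1)` (`Gal(F/K₀)`) and `(2,1)` (`Gal(F/K₁)`) on the sixteen labels. [folklore] -/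
theorem act_tables : (act ((0 : ZMod 4), (1 : ZMod 2)) (s 0 0) = s 0 0 ∧ act ((0 : ZMod 4), (1 : ZMod 2)) (s 0 1) = s 0 1 ∧ act ((0 : ZMod 4), (1 : ZMod 2)) (s 0 2) = s 0 2 ∧ act ((0 : ZMod 4), (1 : ZMod 2)) (s 0 3) = s 0 3 ∧ act ((0 : ZMod 4), (1 : ZMod 2)) (s 1 0) = s 1 2 ∧ act ((0 : ZMod 4), (1 : ZMod 2)) (s 1 2) = s 1 0 ∧ act ((0 : ZMod 4), (1 : ZMod 2)) (s 1 1) = s 1 3 ∧ act ((0 : ZMod 4), (1 : ZMod 2)) (s 1 3) = s 1 1 ∧ act ((0 : ZMod 4), (1 : ZMod 2)) (b 0 0) = b 0 1 ∧ act ((0 : ZMod 4), (1 : ZMod 2)) (b 0 1) = b 0 0 ∧ act ((0 : ZMod 4), (1 : ZMod 2)) (b 1 0) = b 1 1 ∧ act ((0 : ZMod 4), (1 : ZMod 2)) (b 1 1) = b 1 0 ∧ act ((0 : ZMod 4), (1 : ZMod 2)) (b 2 0) = b 2 1 ∧ act ((0 : ZMod 4), (1 : ZMod 2)) (b 2 1)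 = b 2 0 ∧ act ((0 : ZMod 4), (1 : ZMod 2)) (b 3 0) = b 3 1 ∧ act ((0 : ZMod 4), (1 : ZMod 2)) (b 3 1) = b 3 0) ∧ (act ((2 : ZMod 4), (1 : ZMod 2)) (s 0 0) = s 0 2 ∧ act ((2 : ZMod 4), (1 : ZMod 2)) (s 0 1) = s 0 3 ∧ act ((2 : ZMod 4), (1 : ZMod 2)) (s 0 2) = s 0 0 ∧ act ((2 : ZMod 4), (1 : ZMod 2)) (s 0 3) = s 0 1 ∧ act ((2 : ZMod 4), (1 : ZMod 2)) (s 1 0) = s 1 0 ∧ act ((2 : ZMod 4), (1 : ZMod 2)) (s 1 2) = s 1 2 ∧ act ((2 : ZMod 4), (1 : ZMod 2)) (s 1 1) = s 1 1 ∧ act ((2 : ZMod 4), (1 : ZMod 2)) (s 1 3) = s 1 3 ∧ act ((2 : ZMod 4), (1 : ZMod 2)) (b 0 0) = b 2 1 ∧ act ((2 : ZMod 4), (1 : ZMod 2)) (b 0 1) = b 2 0 ∧ act ((2 : ZMod 4), (1 : ZMod 2)) (b 1 0) = b 3 1 ∧ act ((2 : ZMod 4), (1 : ZMod 2)) (b 1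 1) = b 3 0 ∧ act ((2 : ZMod 4), (1 : ZMod 2)) (b 2 0) = b 0 1 ∧ act ((2 : ZMod 4), (1 : ZMod 2)) (b 2 1) = b 0 0 ∧ act ((2 : ZMod 4), (1 : ZMod 2)) (b 3 0) = b 1 1 ∧ act ((2 : ZMod 4), (1 : ZMod 2)) (b 3 1) = b 1 0) := by
  refine ⟨⟨?_, ?_, ?_, ?_, ?_, ?_, ?_, ?_, ?_, ?_, ?_, ?_, ?_, ?_, ?_, ?_⟩, ⟨?_, ?_, ?_, ?_, ?_, ?_, ?_, ?_, ?_, ?_, ?_, ?_, ?_, ?_, ?_, ?_⟩⟩ <;> decide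

/-- **Generalised Weil classes of BOTH quartic subfields have even `S₀`-degree.**  By (W′) the type of a generalised Weil class `⋀^r_{K_i} H¹(X)`
is a `Gal(F/K_i)`-invariant Pohlmann–Hodge vector; for both involutions invariance + Pohlmann force the `S₀`-degree to be EVEN, whereas the
second atom `atom 2 = orbitRep 1` (`S₀ × S₁ × B`, Künneth `(1,1,2)`) has `S₀`-degree `1` (`atom_rows` (iii); `parity_obstruction` of the first
file: `λ₂ = S₀`-degree mod `2` is a `G`-invariant functional on `H` vanishing on the pairs).  So `orbitRep 1` lies outside the type lattice of
the (generalised) Weil classes of ALL proper CM subfields of `F` — exact oracle: `P + W_{K₀} + W_{K₁}` has rank `12` and index `2` in `H`,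
`H/(P + Σ_{K≠F} W_K) ≅ ℤ/2` —, reachable only by `F`-face classes. [cite: MoonenZarhin1998WeilClasses, §2] [cite: Pohlmann1968, Thm 1] -/
theorem invariant_S0deg_even (m : Pt → ℤ) (hH : ∀ g : ZMod 4 × ZMod 2, hodgeForm g m = 0)
    (hinv : (∀ x, m (act ((0 : ZMod 4), (1 : ZMod 2)) x) = m x) ∨ (∀ x, m (act ((2 : ZMod 4), (1 : ZMod 2)) x) = m x)) :
    2 ∣ m (s 0 0) + m (s 0 1) + m (s 0 2) + m (s 0 3) := by
  obtain ⟨⟨t0, t1, t2, t3, t4, t5, t6, t7, t8, t9, t10, t11, t12, t13, t14, t15⟩,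
    ⟨u0, u1, u2, u3, u4, u5, u6, u7, u8, u9, u10, u11, u12, u13, u14, u15⟩⟩ := act_tables
  rw [forall_g] at hH
  simp only [hodgeForm_expand] at hH
  obtain ⟨h0, h1, h2, h3, h4, h5, h6, h7⟩ := hH
  rcases hinv with hinv | hinv
  · rw [forall_pt] at hinv
    simp only [t0, t1, t2, t3, t4, t5, t6, t7, t8, t9, t10, t11, t12, t13, t14, t15] at hinv
    omega
  · rw [forall_pt] at hinv
    simp only [u0, u1, u2, u3, u4, u5, u6, u7, u8, u9, u10, u11, u12, u13, u14, u15] at hinv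
    omega

/-- **The first atom IS a generalised Weil class of the quartic field `K₁`; the second is not of proper-subfield Weil shape.**  (i) `orbitRep 0`
(`S₁ × B`, Künneth `(2,2)`: `T(S₁) ≅ D ⊂ H²(B)`) is invariant under `(2,1)` (generator of `Gal(F/K₁)`, `K₁` = the CM field of `S₁`); (ii) over the
transversal `{(a,0)}` of `G/⟨(2,1)⟩` its traces are `n_B = 1` (every coset of the `B`-labels meets it once), `n_{S₁} = 2` (two `S₁`-labels; the
transversal acts simply transitively on them), `n_{S₀} = 0`: by (W′) it is the type of `⋀⁴_{K₁} H¹(S₁² × B)` — `K₁` acting on `S₁²` through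
`K₁ ⊂ M₂(K₁)`-twists and on `B` through `K₁ ⊂ F` —, a generalised Weil class of a CYCLIC QUARTIC CM field on a CM eightfold
[cite: MoonenZarhin1998WeilClasses, §2]; (iii) `orbitRep 1` has `S₀`-degree `1` and is invariant under neither involution. [folklore] -/
theorem atom_rows :
    (orbitRep 0).image (act ((2 : ZMod 4), (1 : ZMod 2))) = orbitRep 0 ∧
    (∀ x : ZMod 4, ∀ u : ZMod 2, (({((0 : ZMod 4), (0 : ZMod 2)), ((1 : ZMod 4), (0 : ZMod 2)), ((2 : ZMod 4), (0 : ZMod 2)), ((3 : ZMod 4), (0 : ZMod 2))} :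
      Finset (ZMod 4 × ZMod 2)).filter (fun g => b (g.1 + x) (g.2 + u) ∈ orbitRep 0)).card = 1) ∧
    ((orbitRep 0).filter (fun p => ∃ t, p = s 1 t)).card = 2 ∧ ((orbitRep 0).filter (fun p => ∃ t, p = s 0 t)).card = 0 ∧
    (((orbitRep 1).filter (fun p => ∃ t, p = s 0 t)).card = 1 ∧
      (orbitRep 1).image (act ((0 : ZMod 4), (1 : ZMod 2))) ≠ orbitRep 1 ∧ (orbitRep 1).image (act ((2 : ZMod 4), (1 : ZMod 2))) ≠ orbitRep 1) := by
  decide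

end Summit.HodgeConjecture.CorCM.Census.OcticC4C2SquareSpecies
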